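import Summits.ABC.StewartYu.GenThreeInductionArchW
import HarnessLib

/-!
# Cell abc-stewartyu, WP-L.A shell (parcel P-A1): the pivot-weighted Matveev induction WITH THE 2-KUMMER CLAUSE
# carried along — the internal statement `CoreArchWK` of design B's Kummer-conditional archimedean core
# (`ArchCoreKummer`, p1 memo ArchG3-START-design-g9 §3), its step data, dichotomy and induction

`Summits/ABC/StewartYu/GenThreeInductionArchWK.lean` — cell `abc-stewartyu` (HOME `run/shared/lean/pub/abc-stewartyu/`),
route `YuMatveevShapeRat` (rung A1.L, crux r2 `ArchCoreRat`, stmt-ABC-20502), seat p4 (g9), parcel WP-L.A P-A1.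
Three plain `Prop`-valued definitions and theorems; no named fact, no analytic content.

Design B (the archimedean frame of record) keeps the 2-KUMMER hypothesis inside the frame: its half-step
(Nesterenko 2003, §4.3) separates the `2ⁿ` parity classes at the half-integer points by the real multiquadratic
Liouville inequality `Waldschmidt1980Liouville.abs_ev_ge_sharp`, which needs the square classes of the `aⱼ` to
be independent (p5 `ArchG3HalfSeparation`).  A frame that needs its datum 2-Kummer can only feed an induction
whose internal statement CARRIES the Kummer clause, because the induction hypothesis is applied to the step's new
generators `θᵢ = ∏ aⱼ^{Zᵢⱼ}` — which are again 2-Kummer because the obstruction lattice `Φ = span Z` of a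
connected algebraic subgroup is 2-saturated (`KummerBasisChange.qSaturated_span_of_chars`,
`MatveevStepData.exists_matveev_step_data` at `q = 2`).  This file is that induction: the pivot-weighted currency
of `GenThreeInductionArchW` (R29) plus the clause `∀ κ, (∃ γ, ∏ aᵢ^{κᵢ} = γ²) → ∀ i, 2 ∣ κᵢ` (unsigned: the `aᵢ`
are positive, so `−γ²` never occurs).  Its end product is the KUMMER-CONDITIONAL core `ArchCoreKummer`-shaped
text (`archCoreKummer_of_coreWK`: the crux text `ArchCoreRat` with ONE extra clause — a proved special case in
the Kummer regime, the archimedean analogue of `padicCoreOddRat_kummerRung`); the Kummer-FREE crux needs the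
saturated (Θ′) re-run feeding `GenThreeInductionArchW` directly.

Contents: `CoreArchWK`, `StepArchWK`, `DichotomyArchWK`, `core_of_dichotomyWK`, `dichotomyArchWK_of_not_le`,
`stepArchWK_of_pow_eq`, `coreArchWK_mono`, `coreArchWK_of_coreArchW` (the Kummer-free core implies the
conditional one), `kummer_restrict` (a sub-family of a 2-Kummer family is 2-Kummer), `coreArchK_of_coreWK`
(unweighted + Kummer from weighted + Kummer, `C` monotone), `archCoreKummer_of_coreWK`.

WHAT THIS IS NOT: no analytic content; no crux moves; `ArchCoreKummer` is not a route item.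

References: E. M. Matveev, Izv. Math. 64 (2000), (1.3), Thm 2.1; Yu. V. Nesterenko, LNM 1819 (2003), Thm 2.2
(p. 55), Prop. 2.6 (pp. 57–58), §4.3 Lemma 4.4 / Cor. 4.5 (pp. 93–94: Kummer theory on a basis of `𝔑`).
-/

noncomputable section

open Finset

namespace Summit.ABC.StewartYu.GenThreeInductionArchWK

open Summit.ABC.StewartYu.GenThreeInductionArch
open Summit.ABC.StewartYu.GenThreeInductionArchW

/-! ### The pivot-weighted internal statement with the Kummer clause -/

/-- **Internal induction statement of design B's Kummer-conditional archimedean core at rank `r`**: as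
`GenThreeInductionArchW.CoreArchW C r` plus the 2-Kummer clause `∏ aᵢ^{κᵢ} = γ² ⇒ 2 ∣ κ`.
[cite: Matveev2000, (1.3), Thm 2.1 (2-Kummer hypothesis); shape only] -/
def CoreArchWK (C : ℕ → ℝ) (r : ℕ) : Prop :=
  ∀ (a : Fin r → ℚ) (b : Fin r → ℤ) (A : Fin r → ℝ) (B : ℝ) (k₀ : Fin r),
    (∀ i, 0 < a i) →
    (∀ μ : Fin r → ℤ, ∏ i, a i ^ μ i = 1 → μ = 0) →
    (∀ κ : Fin r → ℤ, (∃ γ : ℚ, ∏ i, a i ^ κ i = γ ^ 2) → ∀ i, (2 : ℤ) ∣ κ i) →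
    (∀ i, Height.logHeight₁ (a i) ≤ A i) → (∀ i, 1 ≤ A i) →
    b k₀ ≠ 0 → (∀ i, (|b i| : ℝ) * A i ≤ B * A k₀) →
    -(C r * (∏ i, A i) * Real.log (Real.exp 1 * B)) ≤
      Real.log |∑ i, (b i : ℝ) * Real.log (a i : ℝ)|

/-- **Step data, pivot-weighted with Kummer**: as `StepArchW` plus the 2-Kummer clause for the new generators.
[cite: Nesterenko2003, Prop 2.6 (2.9)–(2.13), Cor 4.5] -/
def StepArchWK (C : ℕ → ℝ) (n : ℕ) (a : Fin n → ℚ) (b : Fin n → ℤ) (A : Fin n → ℝ) (B : ℝ) : Prop :=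
  ∃ (r : ℕ) (θ : Fin r → ℚ) (m : Fin r → ℤ) (A' : Fin r → ℝ) (B' : ℝ) (i₀ : Fin r) (D : ℝ), r < n ∧
    (∀ i, 0 < θ i) ∧
    (∀ μ : Fin r → ℤ, ∏ i, θ i ^ μ i = 1 → μ = 0) ∧
    (∀ κ : Fin r → ℤ, (∃ γ : ℚ, ∏ i, θ i ^ κ i = γ ^ 2) → ∀ i, (2 : ℤ) ∣ κ i) ∧
    (∀ i, Height.logHeight₁ (θ i) ≤ A' i) ∧ (∀ i, 1 ≤ A' i) ∧
    m i₀ ≠ 0 ∧ (∀ i, (|m i| : ℝ) * A' i ≤ B' * A' i₀) ∧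
    Real.log |∑ i, (m i : ℝ) * Real.log (θ i : ℝ)| - D ≤
      Real.log |∑ j, (b j : ℝ) * Real.log (a j : ℝ)| ∧
    C r * (∏ i, A' i) * Real.log (Real.exp 1 * B') + D ≤
      C n * (∏ j, A j) * Real.log (Real.exp 1 * B)

/-- **The per-rank dichotomy, pivot-weighted with Kummer.** [cite: Nesterenko2003, Prop 2.6] -/
def DichotomyArchWK (C : ℕ → ℝ) (n : ℕ) : Prop :=
  ∀ (a : Fin n → ℚ) (b : Fin n → ℤ) (A : Fin n → ℝ) (B : ℝ) (k₀ : Fin n),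
    (∀ j, 0 < a j) →
    (∀ μ : Fin n → ℤ, ∏ j, a j ^ μ j = 1 → μ = 0) →
    (∀ κ : Fin n → ℤ, (∃ γ : ℚ, ∏ j, a j ^ κ j = γ ^ 2) → ∀ j, (2 : ℤ) ∣ κ j) →
    (∀ j, Height.logHeight₁ (a j) ≤ A j) → (∀ j, 1 ≤ A j) →
    b k₀ ≠ 0 → (∀ j, (|b j| : ℝ) * A j ≤ B * A k₀) →
    -(C n * (∏ j, A j) * Real.log (Real.exp 1 * B)) ≤
        Real.log |∑ j, (b j : ℝ) * Real.log (a j : ℝ)| ∨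
      StepArchWK C n a b A B

/-! ### The induction -/

/-- **Matveev's induction, pivot-weighted with Kummer.** [cite: Nesterenko2003, Thm 2.2 from Prop 2.6] -/
theorem core_of_dichotomyWK {C : ℕ → ℝ} (hD : ∀ n, DichotomyArchWK C n) : ∀ r, CoreArchWK C r := by
  intro r
  induction r using Nat.strong_induction_on with
  | _ n ih =>
    intro a b A B k₀ ha hind hK hA hA1 hk₀ hBw
    rcases hD n a b A B k₀ ha hind hK hA hA1 hk₀ hBw with hle | hstep
    · exact hle
    · obtain ⟨r, θ, m, A', B', i₀, D, hr, hθ, hindθ, hKθ, hA', hA1', hm, hB', hcmp, hcost⟩ := hstep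
      have hIH := ih r hr θ m A' B' i₀ hθ hindθ hKθ hA' hA1' hm hB'
      linarith

/-- The frame's working form: ASSUME the negated bound and produce the step. [cite: Nesterenko2003, (2.14)] -/
theorem dichotomyArchWK_of_not_le {C : ℕ → ℝ} {n : ℕ}
    (h : ∀ (a : Fin n → ℚ) (b : Fin n → ℤ) (A : Fin n → ℝ) (B : ℝ) (k₀ : Fin n),
      (∀ j, 0 < a j) →
      (∀ μ : Fin n → ℤ, ∏ j, a j ^ μ j = 1 → μ = 0) →
      (∀ κ : Fin n → ℤ, (∃ γ : ℚ, ∏ j, a j ^ κ j = γ ^ 2) → ∀ j, (2 : ℤ) ∣ κ j) →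
      (∀ j, Height.logHeight₁ (a j) ≤ A j) → (∀ j, 1 ≤ A j) →
      b k₀ ≠ 0 → (∀ j, (|b j| : ℝ) * A j ≤ B * A k₀) →
      ¬ -(C n * (∏ j, A j) * Real.log (Real.exp 1 * B)) ≤
          Real.log |∑ j, (b j : ℝ) * Real.log (a j : ℝ)| →
      StepArchWK C n a b A B) :
    DichotomyArchWK C n := by
  intro a b A B k₀ ha hind hK hA hA1 hk₀ hBw
  by_cases hle : -(C n * (∏ j, A j) * Real.log (Real.exp 1 * B)) ≤
      Real.log |∑ j, (b j : ℝ) * Real.log (a j : ℝ)|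
  · exact Or.inl hle
  · exact Or.inr (h a b A B k₀ ha hind hK hA hA1 hk₀ hBw hle)

/-- **The step from the algebraic relation, pivot-weighted with Kummer.** [cite: Nesterenko2003, Prop 2.6] -/
theorem stepArchWK_of_pow_eq {C : ℕ → ℝ} {n : ℕ} {a : Fin n → ℚ} {b : Fin n → ℤ} {A : Fin n → ℝ} {B : ℝ}
    (ha : ∀ j, 0 < a j) {r : ℕ} (hr : r < n)
    (θ : Fin r → ℚ) (m : Fin r → ℤ) (A' : Fin r → ℝ) (B' : ℝ) (i₀ : Fin r)
    (hθ : ∀ i, 0 < θ i) (hindθ : ∀ μ : Fin r → ℤ, ∏ i, θ i ^ μ i = 1 → μ = 0)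
    (hKθ : ∀ κ : Fin r → ℤ, (∃ γ : ℚ, ∏ i, θ i ^ κ i = γ ^ 2) → ∀ i, (2 : ℤ) ∣ κ i)
    (hA' : ∀ i, Height.logHeight₁ (θ i) ≤ A' i) (hA1' : ∀ i, 1 ≤ A' i)
    (hm : m i₀ ≠ 0) (hB' : ∀ i, (|m i| : ℝ) * A' i ≤ B' * A' i₀)
    (m₀ : ℤ) (hm₀ : m₀ ≠ 0) (hrel : ∏ i, θ i ^ m i = (∏ j, a j ^ b j) ^ m₀)
    (hcost : C r * (∏ i, A' i) * Real.log (Real.exp 1 * B') + Real.log |(m₀ : ℝ)| ≤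
      C n * (∏ j, A j) * Real.log (Real.exp 1 * B)) :
    StepArchWK C n a b A B :=
  ⟨r, θ, m, A', B', i₀, Real.log |(m₀ : ℝ)|, hr, hθ, hindθ, hKθ, hA', hA1', hm, hB',
    log_abs_sub_log_abs_le_of_pow_eq a ha b θ hθ m m₀ hm₀ hrel, hcost⟩

/-- Monotonicity in the constant. [folklore] -/
theorem coreArchWK_mono {C C' : ℕ → ℝ} {r : ℕ} (hCC' : C r ≤ C' r) (h : CoreArchWK C r) : CoreArchWK C' r := by
  intro a b A B k₀ ha hind hK hA hA1 hk₀ hBw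
  have hcore := h a b A B k₀ ha hind hK hA hA1 hk₀ hBw
  have hprod : 0 ≤ ∏ i, A i := zero_le_one.trans (one_le_prod_weights hA1)
  have hlog : 0 ≤ Real.log (Real.exp 1 * B) :=
    zero_le_one.trans (one_le_log_exp_one_mul (one_le_boundW hA1 hk₀ hBw))
  have hle : C r * (∏ i, A i) * Real.log (Real.exp 1 * B) ≤
      C' r * (∏ i, A i) * Real.log (Real.exp 1 * B) :=
    mul_le_mul_of_nonneg_right (mul_le_mul_of_nonneg_right hCC' hprod) hlog
  linarith

/-- The Kummer-FREE pivot-weighted core implies the Kummer-conditional one (drop a hypothesis). [folklore] -/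
theorem coreArchWK_of_coreArchW {C : ℕ → ℝ} {r : ℕ} (h : CoreArchW C r) : CoreArchWK C r :=
  fun a b A B k₀ ha hind _hK hA hA1 hk₀ hBw => h a b A B k₀ ha hind hA hA1 hk₀ hBw

/-! ### The Kummer-conditional UNWEIGHTED text from the weighted one -/

/-- **A sub-family of a 2-Kummer family is 2-Kummer**: restrict the Kummer clause along any map of index sets
`e : Fin r → Fin n` with a left inverse on its image — here along an injection, by extending exponent vectors by
zero. [folklore] -/
theorem kummer_restrict {n r : ℕ} (a : Fin n → ℚ)
    (hK : ∀ κ : Fin n → ℤ, (∃ γ : ℚ, ∏ j, a j ^ κ j = γ ^ 2) → ∀ j, (2 : ℤ) ∣ κ j)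
    (e : Fin r → Fin n) (he : Function.Injective e) :
    ∀ κ : Fin r → ℤ, (∃ γ : ℚ, ∏ i, a (e i) ^ κ i = γ ^ 2) → ∀ i, (2 : ℤ) ∣ κ i := by
  classical
  intro κ hκ i
  -- extend `κ` by zero outside the image of `e`
  set κ' : Fin n → ℤ := fun j => if h : ∃ i, e i = j then κ (Classical.choose h) else 0 with hκ'
  have hκ'e : ∀ i, κ' (e i) = κ i := by
    intro i
    have h : ∃ i', e i' = e i := ⟨i, rfl⟩
    simp only [hκ', h, dite_true]
    congr 1
    exact he (Classical.choose_spec h)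
  have hprod : ∏ j, a j ^ κ' j = ∏ i, a (e i) ^ κ i := by
    -- split the product over the image of `e` and its complement
    rw [← Finset.prod_filter_mul_prod_filter_not Finset.univ (fun j => ∃ i, e i = j)]
    have h1 : ∏ j ∈ Finset.univ.filter (fun j => ¬ ∃ i, e i = j), a j ^ κ' j = 1 := by
      refine Finset.prod_eq_one fun j hj => ?_
      simp only [Finset.mem_filter, Finset.mem_univ, true_and] at hj
      simp [hκ', hj]
    rw [h1, mul_one]
    have h2 : Finset.univ.filter (fun j => ∃ i, e i = j) = Finset.univ.image e := by
      ext j; simp [eq_comm]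
    rw [h2, Finset.prod_image fun i _ i' _ h => he h]
    exact Finset.prod_congr rfl fun i _ => by rw [hκ'e]
  obtain ⟨γ, hγ⟩ := hκ
  have h := hK κ' ⟨γ, by rw [hprod, hγ]⟩ (e i)
  rwa [hκ'e] at h

/-- **UNWEIGHTED + Kummer from WEIGHTED + Kummer**: for a monotone non-negative `C`, `CoreArchWK C` at every rank
gives, at every rank, the crux-text bound for all unweighted 2-Kummer data (`b ≠ 0`, `|bᵢ| ≤ B`): delete the zero
coordinates (the restriction stays 2-Kummer, `kummer_restrict`; `Ω` decreases) and take the pivot at the maximal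
weight. [cite: Nesterenko2003, §2 p. 56; Matveev2000, (1.3)] -/
theorem coreArchK_of_coreWK {C : ℕ → ℝ} (hC0 : ∀ r, 0 ≤ C r) (hCmono : Monotone C)
    (h : ∀ r, CoreArchWK C r) (n : ℕ)
    (a : Fin n → ℚ) (b : Fin n → ℤ) (A : Fin n → ℝ) (B : ℝ)
    (ha : ∀ i, 0 < a i) (hind : ∀ μ : Fin n → ℤ, ∏ i, a i ^ μ i = 1 → μ = 0)
    (hK : ∀ κ : Fin n → ℤ, (∃ γ : ℚ, ∏ i, a i ^ κ i = γ ^ 2) → ∀ i, (2 : ℤ) ∣ κ i)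
    (hA : ∀ i, Height.logHeight₁ (a i) ≤ A i) (hA1 : ∀ i, 1 ≤ A i)
    (hb : b ≠ 0) (hB : ∀ i, (|b i| : ℝ) ≤ B) :
    -(C n * (∏ i, A i) * Real.log (Real.exp 1 * B)) ≤ Real.log |∑ i, (b i : ℝ) * Real.log (a i : ℝ)| := by
  classical
  -- restrict to the support of `b`
  set s : Finset (Fin n) := Finset.univ.filter fun j => b j ≠ 0 with hs
  set r : ℕ := s.card with hrdef
  set e : Fin r ≃ s := s.equivFin.symm with he
  set emb : Fin r → Fin n := fun i => (e i : Fin n) with hemb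
  have hembinj : Function.Injective emb := fun i i' h => e.injective (Subtype.ext h)
  have hrn : r ≤ n := by simpa [hrdef] using Finset.card_le_univ s
  -- the restricted datum
  set θ : Fin r → ℚ := fun i => a (emb i) with hθdef
  set m : Fin r → ℤ := fun i => b (emb i) with hmdef
  set A' : Fin r → ℝ := fun i => A (emb i) with hA'def
  have hreidx : ∀ (f : Fin n → ℚ), ∏ i, f (emb i) = ∏ j ∈ s, f j := by
    intro f
    rw [show (fun i => f (emb i)) = fun i => (fun x : s => f x) (e i) from rfl, Equiv.prod_comp e (fun x : s => f x),
      Finset.prod_coe_sort]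
  have hreidxR : ∀ (f : Fin n → ℝ), ∏ i, f (emb i) = ∏ j ∈ s, f j := by
    intro f
    rw [show (fun i => f (emb i)) = fun i => (fun x : s => f x) (e i) from rfl, Equiv.prod_comp e (fun x : s => f x),
      Finset.prod_coe_sort]
  have hreidxS : ∀ (f : Fin n → ℝ), ∑ i, f (emb i) = ∑ j ∈ s, f j := by
    intro f
    rw [show (fun i => f (emb i)) = fun i => (fun x : s => f x) (e i) from rfl, Equiv.sum_comp e (fun x : s => f x),
      Finset.sum_coe_sort]
  -- the linear form and `Ω` of the restriction
  have hΛ : ∑ i, (m i : ℝ) * Real.log (θ i : ℝ) = ∑ j, (b j : ℝ) * Real.log (a j : ℝ) := by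
    have h1 : ∑ i, (m i : ℝ) * Real.log (θ i : ℝ) = ∑ j ∈ s, (b j : ℝ) * Real.log (a j : ℝ) := by
      simpa [hθdef, hmdef] using hreidxS (fun j => (b j : ℝ) * Real.log (a j : ℝ))
    rw [h1]
    exact Finset.sum_filter_of_ne fun j _ hj => by
      intro hbj; apply hj; rw [hbj]; simp
  have hΩ : ∏ i, A' i ≤ ∏ j, A j := by
    have h1 : ∏ i, A' i = ∏ j ∈ s, A j := by simpa [hA'def] using hreidxR A
    rw [h1, ← Finset.prod_filter_mul_prod_filter_not Finset.univ (fun j => b j ≠ 0) A]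
    have h2 : 1 ≤ ∏ j ∈ Finset.univ.filter (fun j => ¬ b j ≠ 0), A j :=
      Finset.one_le_prod fun j _ => hA1 j
    have h3 : 0 ≤ ∏ j ∈ s, A j := Finset.prod_nonneg fun j _ => by linarith [hA1 j]
    calc ∏ j ∈ s, A j = (∏ j ∈ s, A j) * 1 := (mul_one _).symm
      _ ≤ (∏ j ∈ s, A j) * ∏ j ∈ Finset.univ.filter (fun j => ¬ b j ≠ 0), A j :=
          mul_le_mul_of_nonneg_left h2 h3
  -- independence and Kummer of the restriction
  have hindθ : ∀ μ : Fin r → ℤ, ∏ i, θ i ^ μ i = 1 → μ = 0 := by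
    intro μ hμ
    set μ' : Fin n → ℤ := fun j => if h : j ∈ s then μ (e.symm ⟨j, h⟩) else 0 with hμ'
    have h1 : ∏ j, a j ^ μ' j = 1 := by
      have h2 : ∏ j, a j ^ μ' j = ∏ j ∈ s, a j ^ μ' j := by
        symm
        exact Finset.prod_filter_of_ne fun j _ hj => by
          by_contra hjs
          apply hj
          have : μ' j = 0 := by simp [hμ', hs] at hjs ⊢; intro h; exact absurd hjs h
          rw [this, zpow_zero]
      rw [h2, ← hreidx (fun j => a j ^ μ' j)]
      have h3 : ∀ i, a (emb i) ^ μ' (emb i) = θ i ^ μ i := by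
        intro i
        have hmem : emb i ∈ s := (e i).2
        have : μ' (emb i) = μ i := by
          simp only [hμ', hmem, dite_true]
          congr 1
          have : (⟨emb i, hmem⟩ : s) = e i := Subtype.ext rfl
          rw [this, Equiv.symm_apply_apply]
        rw [this]
      rw [Finset.prod_congr rfl fun i _ => h3 i]
      exact hμ
    have h4 := hind μ' h1
    funext i
    have h5 := congrFun h4 (emb i)
    have hmem : emb i ∈ s := (e i).2
    simp only [hμ', hmem, dite_true, Pi.zero_apply] at h5
    have : (⟨emb i, hmem⟩ : s) = e i := Subtype.ext rfl
    rw [this, Equiv.symm_apply_apply] at h5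
    exact h5
  have hKθ := kummer_restrict a hK emb hembinj
  -- the pivot at the maximal weight of the restriction (the support is nonempty)
  have hne : (Finset.univ : Finset (Fin r)).Nonempty := by
    obtain ⟨k, hk⟩ : ∃ k, b k ≠ 0 := by
      by_contra h0; push Not at h0; exact hb (funext h0)
    have hks : k ∈ s := by simp [hs, hk]
    exact ⟨e.symm ⟨k, hks⟩, Finset.mem_univ _⟩
  obtain ⟨i₀, -, hi₀⟩ := Finset.exists_max_image Finset.univ A' hne
  have hmi₀ : m i₀ ≠ 0 := by
    have : emb i₀ ∈ s := (e i₀).2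
    simpa [hs] using this
  have hB1 : 1 ≤ B := one_le_bound hb hB
  have hBw : ∀ i, (|m i| : ℝ) * A' i ≤ B * A' i₀ := fun i =>
    mul_le_mul (hB _) (hi₀ i (Finset.mem_univ i)) (by simp only [hA'def]; linarith [hA1 (emb i)]) (by linarith)
  -- apply the weighted core at rank `r` and transport
  have hcore := h r θ m A' B i₀ (fun i => ha _) hindθ hKθ (fun i => hA _) (fun i => hA1 _) hmi₀ hBw
  rw [hΛ] at hcore
  have hlogB : 0 ≤ Real.log (Real.exp 1 * B) := zero_le_one.trans (one_le_log_exp_one_mul hB1)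
  have hA'0 : 0 ≤ ∏ i, A' i := Finset.prod_nonneg fun i _ => by simp only [hA'def]; linarith [hA1 (emb i)]
  have hle : C r * (∏ i, A' i) * Real.log (Real.exp 1 * B) ≤ C n * (∏ j, A j) * Real.log (Real.exp 1 * B) :=
    mul_le_mul_of_nonneg_right
      ((mul_le_mul_of_nonneg_right (hCmono hrn) hA'0).trans (mul_le_mul_of_nonneg_left hΩ (hC0 n))) hlogB
  linarith

/-- **The Kummer-conditional archimedean core text** (`ArchCoreKummer`: the route's crux text `ArchCoreRat` with
ONE extra clause, the 2-Kummer condition — design B's stage-1 theorem and the archimedean analogue of the T3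
rungs `padicCoreOddRat_kummerRung`) **from the pivot-weighted Kummer-carrying internal statement at every rank**,
for one admissible monotone `0 ≤ C r ≤ c₁ʳ`. [cite: Nesterenko2003, Thm 2.2 (p. 55); Matveev2000, Cor 2.3; shape only] -/
theorem archCoreKummer_of_coreWK {C : ℕ → ℝ} {c₁ : ℝ} (hC : ∀ r, 0 ≤ C r ∧ C r ≤ c₁ ^ r) (hCmono : Monotone C)
    (hcore : ∀ r, CoreArchWK C r) :
    ∃ c : ℝ, ∀ (r : ℕ) (a : Fin r → ℚ) (b : Fin r → ℤ) (A : Fin r → ℝ) (B : ℝ),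
      (∀ i, 0 < a i) →
      (∀ μ : Fin r → ℤ, ∏ i, a i ^ μ i = 1 → μ = 0) →
      (∀ κ : Fin r → ℤ, (∃ γ : ℚ, ∏ i, a i ^ κ i = γ ^ 2) → ∀ i, (2 : ℤ) ∣ κ i) →
      (∀ i, Height.logHeight₁ (a i) ≤ A i) → (∀ i, 1 ≤ A i) →
      b ≠ 0 → (∀ i, (|b i| : ℝ) ≤ B) →
      -(c ^ r * (∏ i, A i) * Real.log (Real.exp 1 * B)) ≤
        Real.log |∑ i, (b i : ℝ) * Real.log (a i : ℝ)| := by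
  refine ⟨c₁, fun r a b A B ha hind hK hA hA1 hb hB => ?_⟩
  have h := coreArchK_of_coreWK (fun r => (hC r).1) hCmono hcore r a b A B ha hind hK hA hA1 hb hB
  have hprod : 0 ≤ ∏ i, A i := zero_le_one.trans (one_le_prod_weights hA1)
  have hlog : 0 ≤ Real.log (Real.exp 1 * B) := log_exp_one_mul_nonneg hb hB
  have hle : C r * (∏ i, A i) * Real.log (Real.exp 1 * B) ≤
      c₁ ^ r * (∏ i, A i) * Real.log (Real.exp 1 * B) :=
    mul_le_mul_of_nonneg_right (mul_le_mul_of_nonneg_right (hC r).2 hprod) hlog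
  linarith

end Summit.ABC.StewartYu.GenThreeInductionArchWK

end
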